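/-
DilationProbe.lean — plan-lens-HodgeAV-strengthen g0 (planner; E3 «strengthen», BLOCK E3 of director-hodge g20 req-80; memo-02).

THE DILATION PRINCIPLE (typed + kernel probes; the general invariance statements are `def … : Prop` CONJECTURE SHELLS with pencil proofs
in memo-02, NOT theorems here). `D_m : (α, x, y) ↦ (m·α, m·x, m·y)` on letters, cells, configurations (`m ≥ 1`).
* §1 `dilPt ∕ MCell.dil ∕ MConfig.dil`.
* §2 CLASS SIDE (kernel): `bphi (D_m x) l = w_m l · bphi x l` with `w_m = (1, m, m, m, m, m²)` — hence `ch(D_m Z)` is `ch(Z)` rescaled word by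
  word by `m^{deg}` (`deg e = deg ē = deg A = 1`, `deg p = 2`), so (H1)-cleanness is `D_m`-invariant and `μ ↦ m⁴ μ` (memo-02 §1; the design-level
  check on the dilate of `08162ddb` is in `eng/run-dilate.log`).
* §3 STATIC SIDE (kernel, v1.1): **`staticDilationInvariant_holds : StaticDilationInvariant`** — for every configuration `C` and every
  `m ≥ 1`: `RuleDMu4Closed C ↔ RuleDMu4Closed (D_m C)`, `XresFourClosed C ↔ XresFourClosed (D_m C)` (the `X−, X+, A2I−, A2I+` instance
  families of `Pad4TowerXresFamilies`, both worlds: `D_m` commutes with the dual `(α, β) ↦ (−α, −β)`), `G1Closed C ↔ G1Closed (D_m C)`; proved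
  primitive by primitive (`ray`, `coord`, `Adapted`, `isApex`, `DirOK`, `MAgree∕MAgree2`, legs, `UPartner`, service∕covers, `Sibling`,
  `NoCompanion`, `HeOkP`, `HbOkP`, `WfEmpty`, `Effective∕Timelike∕Spacelike∕NullBelow`, `cabs`, `EncDir`, the A2I guard, `OnULineBelowEq`, the
  (3b)∕(3d) clauses, `Perm∕Δ`-closure); and `fc1_closed_of_dil : 2 ≤ m → FC1Mu4Closed (D_m C)` for EVERY `C` (no unit ray survives dilation).
  `decide` PROBES kept as sanity checks (`ownPhaseProbe`, `towerNextToO`, `dml8Pattern`, `j275278Column` under `D_2`).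
HONEST FRAMING: the invariance covers EXACTLY the families typed in the tree (RULE D μ₄, X±, A2I±, G₁, FC1); any further clause of a cell
instrument not among these is not covered (memo-02 (A-γ) runs the instrument itself). A dilated design is NOT a monad, NOT a SOURCE, NOT a
SEED; nothing here is toward 18881∕H2, HC_AV, HC_CM or HC. No `instance`, no notation, nothing claimed beyond the displayed theorems;
BANNED options absent; axioms standard.
-/
import Summits.Ventures.HSemireg.Pad4TowerXresFamilies
import Summits.Ventures.HSemireg.Pad4TowerFC1Mu4
import Summits.Ventures.HSemireg.Pad4TowerSeedB1
import Summits.Ventures.HSemireg.Pad4TowerPsiSubA1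

namespace Summit.HodgeConjecture.HodgeConjecture.Cruxes.BlochSeedDiscOne.StrengthenDilation

open Summit.Ventures.HSemireg Summit.Ventures.HSemireg.Pad4Tower Finset

/-! ## §1 The dilation -/

/-- `D_m` on a letter point. -/
def dilPt (m : ℤ) (x : BPoint) : BPoint := (m * x.1, m * x.2.1, m * x.2.2)

/-- `D_m` on a cell. -/
def cellDil (m : ℤ) (Z : MCell) : MCell := fun f => dilPt m (Z f)

/-- `D_m` on a configuration (both levels). -/
def configDil (m : ℤ) (C : MConfig) : MConfig := ⟨C.lower.image (cellDil m), C.upper.image (cellDil m)⟩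

/-! ## §2 Class side: `bphi ∘ D_m` is a diagonal rescaling -/

/-- the weight vector `w_m = (1, m, m, m, m, m²)` on the six balanced-block slots `(1, α, α, β, β̄, α² − |β|²)`. -/
def dilWeight (m : ℤ) : Fin 6 → GaussianInt := ![1, m, m, m, m, (m : GaussianInt) ^ 2]

/-- **`bphi (D_m x) = w_m • bphi x` slot by slot.** [kernel] -/
theorem bphi_dilPt (m : ℤ) (x : BPoint) (l : Fin 6) : bphi (dilPt m x) l = dilWeight m l * bphi x l := by
  obtain ⟨a, b, c⟩ := x
  fin_cases l <;> simp [bphi, phiVec, dilPt, dilWeight] <;> ring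

/-- (typed consequence, memo-02 §1; pencil: expand `ch = ⊗_f bphi`, each word of total degree `d` — `A, e, ē` weight 1, `p` weight 2 — is
multiplied by `m^d`; (H1)'s «mixed `e∕ē` words vanish» and «e-free words of equal degree agree» are invariant under a per-degree rescaling;
`μ = E_{eeee} ↦ m⁴ μ`.) CLASS DILATION INVARIANCE as a Prop over signed finitely supported designs `ν : MCell → ℤ`, stated through the
screen words: for every word `w`, `Σ_Z ν(Z) ch(D_m Z)(w) = m^{deg w} Σ_Z ν(Z) ch(Z)(w)`. -/
def wordDeg (w : CWord) : ℕ := ∑ f, (![0, 1, 1, 1, 1, 2] (w f) : ℕ)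

/-- the word-by-word rescaling law (conjecture shell at this generality; the slot law `bphi_dilPt` is its factorwise input). -/
def ChDilationLaw : Prop :=
  ∀ (m : ℤ) (Z : MCell) (w : CWord), (cellDil m Z).ch w = (m : GaussianInt) ^ wordDeg w * Z.ch w

/-! ## §3 Static side -/

/-- **FC1 is VACUOUS on every dilate** (`m ≥ 2`): no letter of `D_m C` is a unit ray, so `FC1Mu4N` is never triggered. [kernel] -/
theorem fc1_closed_of_dil (C : MConfig) (m : ℤ) (hm : 2 ≤ m) : FC1Mu4Closed (configDil m C) := by
  intro Z hZ _ σ f _ hunit _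
  exfalso
  simp only [configDil, Finset.mem_image] at hZ
  obtain ⟨Z₀, -, rfl⟩ := hZ
  obtain ⟨k, hk⟩ := hunit
  have h1 : (cellDil m Z₀ σ).1 = (lpt 1 k).1 := by rw [hk]
  have h2 : (lpt 1 k).1 = 1 := by fin_cases k <;> rfl
  simp only [cellDil, dilPt, h2] at h1
  -- `m * a = 1` with `m ≥ 2`: impossible
  have hm1 : m ∣ 1 := ⟨(Z₀ σ).1, h1.symm⟩
  have := Int.le_of_dvd one_pos hm1
  omega

/-- **STATIC DILATION INVARIANCE** (stated here, PROVED below as `staticDilationInvariant_holds`; memo-02 §2: every primitive of RULE D μ₄ ∕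
the `X` and `A2I` families ∕ `G₁` is a Boolean combination of (i) signs of linear forms in the coordinates, (ii) (in)equalities of homogeneous quadratic forms of coordinate
differences, (iii) `y = ray x k e` with `e` otherwise unconstrained, (iv) quantifiers over PRESENT cells — all of which commute with `D_m`,
`m ≥ 1`; the dual world `(α, β) ↦ (−α, −β)` commutes with `D_m` too). -/
def StaticDilationInvariant : Prop :=
  ∀ (C : MConfig) (m : ℤ), 1 ≤ m →
    (RuleDMu4Closed C ↔ RuleDMu4Closed (configDil m C)) ∧ (XresFourClosed C ↔ XresFourClosed (configDil m C)) ∧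
      (C.G1Closed ↔ (configDil m C).G1Closed)

/-! ### RULE D μ₄ and `G₁` are `D_m`-invariant (kernel; `m ≥ 1`) -/

section Invariance

variable {m : ℤ}

theorem cellDil_apply (m : ℤ) (Z : MCell) (f : Fin 4) : cellDil m Z f = dilPt m (Z f) := rfl

theorem dilPt_injective (hm : m ≠ 0) : Function.Injective (dilPt m) := by
  rintro ⟨a, b, c⟩ ⟨a', b', c'⟩ h
  simp only [dilPt, Prod.mk.injEq] at h
  obtain ⟨h1, h2, h3⟩ := h
  simp [mul_left_cancel₀ hm h1, mul_left_cancel₀ hm h2, mul_left_cancel₀ hm h3]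

theorem dilPt_inj (hm : m ≠ 0) {x y : BPoint} : dilPt m x = dilPt m y ↔ x = y := (dilPt_injective hm).eq_iff

theorem cellDil_injective (hm : m ≠ 0) : Function.Injective (cellDil m) :=
  fun _ _ h => funext fun f => dilPt_injective hm (congrFun h f)

/-- `D_m` commutes with moving along a null ray (the multiplicity scales). -/
theorem dilPt_ray (m : ℤ) (x : BPoint) (k : Fin 4) (e : ℤ) : dilPt m (ray x k e) = ray (dilPt m x) k (m * e) := by
  obtain ⟨a, b, c⟩ := x
  fin_cases k <;> refine Prod.ext ?_ (Prod.ext ?_ ?_) <;> simp [dilPt, ray] <;> ring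

theorem coord_dilPt (m : ℤ) (x : BPoint) (k : Fin 4) : coord (dilPt m x) k = m * coord x k := by
  obtain ⟨a, b, c⟩ := x
  fin_cases k <;> simp [coord, dilPt] <;> ring

theorem adapted_dilPt (hm : m ≠ 0) (x : BPoint) (k : Fin 4) : Adapted (dilPt m x) k ↔ Adapted x k := by
  obtain ⟨a, b, c⟩ := x
  fin_cases k <;> simp [Adapted, dilPt, hm]

theorem isApex_dilPt (hm : m ≠ 0) (x : BPoint) : isApex (dilPt m x) ↔ isApex x := by
  obtain ⟨a, b, c⟩ := x
  simp [isApex, dilPt, hm]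

theorem dirOK_dilPt (hm : m ≠ 0) (x : BPoint) (k a : Fin 4) : DirOK (dilPt m x) k a ↔ DirOK x k a := by
  simp only [DirOK, isApex_dilPt hm]

theorem magree_dil (hm : m ≠ 0) (P Z : MCell) (σ : Fin 4) : MAgree (cellDil m P) (cellDil m Z) σ ↔ MAgree P Z σ := by
  simp only [MAgree, cellDil_apply, dilPt_inj hm]

theorem magree2_dil (hm : m ≠ 0) (P Z : MCell) (g j : Fin 4) :
    MAgree2 (cellDil m P) (cellDil m Z) g j ↔ MAgree2 P Z g j := by
  simp only [MAgree2, cellDil_apply, dilPt_inj hm]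

/-- the two halves of the leg relation `x = y + d·n_k`, `d = α(x) − α(y) > 0`, are `D_m`-invariant (`m > 0`). -/
theorem fst_lt_dil (hm : 0 < m) (x y : BPoint) : (dilPt m y).1 < (dilPt m x).1 ↔ y.1 < x.1 :=
  ⟨fun h => lt_of_mul_lt_mul_left h hm.le, fun h => mul_lt_mul_of_pos_left h hm⟩

theorem fst_le_dil (hm : 0 < m) (x y : BPoint) : (dilPt m y).1 ≤ (dilPt m x).1 ↔ y.1 ≤ x.1 :=
  ⟨fun h => le_of_mul_le_mul_left h hm, fun h => mul_le_mul_of_nonneg_left h hm.le⟩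

theorem eq_ray_dil (hm : m ≠ 0) (x y : BPoint) (k : Fin 4) :
    dilPt m x = ray (dilPt m y) k ((dilPt m x).1 - (dilPt m y).1) ↔ x = ray y k (x.1 - y.1) := by
  rw [show (dilPt m x).1 - (dilPt m y).1 = m * (x.1 - y.1) by simp only [dilPt]; ring, ← dilPt_ray, dilPt_inj hm]

theorem upartner_dil (hm : 0 < m) (Z q : MCell) (σ k : Fin 4) :
    UPartner (cellDil m Z) (cellDil m q) σ k ↔ UPartner Z q σ k := by
  simp only [UPartner, magree_dil hm.ne', cellDil_apply, fst_lt_dil hm, eq_ray_dil hm.ne']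

theorem exists_upper_dil {C : MConfig} {p : MCell → Prop} :
    (∃ P ∈ (configDil m C).upper, p P) ↔ ∃ P ∈ C.upper, p (cellDil m P) := by
  simp only [configDil, Finset.exists_mem_image]

theorem exists_lower_dil {C : MConfig} {p : MCell → Prop} :
    (∃ N ∈ (configDil m C).lower, p N) ↔ ∃ N ∈ C.lower, p (cellDil m N) := by
  simp only [configDil, Finset.exists_mem_image]

theorem forall_upper_dil {C : MConfig} {p : MCell → Prop} :
    (∀ P ∈ (configDil m C).upper, p P) ↔ ∀ P ∈ C.upper, p (cellDil m P) := by
  simp only [configDil, Finset.forall_mem_image]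

theorem forall_lower_dil {C : MConfig} {p : MCell → Prop} :
    (∀ N ∈ (configDil m C).lower, p N) ↔ ∀ N ∈ C.lower, p (cellDil m N) := by
  simp only [configDil, Finset.forall_mem_image]

theorem mservedBelow_dil (hm : 0 < m) (C : MConfig) (Z : MCell) (f k : Fin 4) :
    MServedBelow (configDil m C) (cellDil m Z) f k ↔ MServedBelow C Z f k := by
  simp only [MServedBelow, exists_upper_dil, upartner_dil hm]

theorem mservedAbove_dil (hm : 0 < m) (C : MConfig) (P : MCell) (f k : Fin 4) :
    MServedAbove (configDil m C) (cellDil m P) f k ↔ MServedAbove C P f k := by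
  simp only [MServedAbove, exists_lower_dil, upartner_dil hm]

theorem settledBelow_dil (hm : 0 < m) (C : MConfig) (Z : MCell) (f k : Fin 4) :
    SettledBelow (configDil m C) (cellDil m Z) f k ↔ SettledBelow C Z f k := by
  simp only [SettledBelow, mservedBelow_dil hm]

theorem settledAbove_dil (hm : 0 < m) (C : MConfig) (P : MCell) (f k : Fin 4) :
    SettledAbove (configDil m C) (cellDil m P) f k ↔ SettledAbove C P f k := by
  simp only [SettledAbove, mservedAbove_dil hm]

theorem mcoverBelow_dil (hm : 0 < m) (C : MConfig) (Z : MCell) (g a j b : Fin 4) :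
    MCoverBelow (configDil m C) (cellDil m Z) g a j b ↔ MCoverBelow C Z g a j b := by
  simp only [MCoverBelow, exists_upper_dil, magree2_dil hm.ne', cellDil_apply, fst_lt_dil hm, eq_ray_dil hm.ne']

theorem mcoverAbove_dil (hm : 0 < m) (C : MConfig) (P : MCell) (g a j b : Fin 4) :
    MCoverAbove (configDil m C) (cellDil m P) g a j b ↔ MCoverAbove C P g a j b := by
  simp only [MCoverAbove, exists_lower_dil, magree2_dil hm.ne', cellDil_apply, fst_lt_dil hm, eq_ray_dil hm.ne']

theorem coveredBelow_dil (hm : 0 < m) (C : MConfig) (Z : MCell) (g k j k' : Fin 4) :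
    CoveredBelow (configDil m C) (cellDil m Z) g k j k' ↔ CoveredBelow C Z g k j k' := by
  simp only [CoveredBelow, cellDil_apply, dirOK_dilPt hm.ne', mcoverBelow_dil hm]

theorem coveredAbove_dil (hm : 0 < m) (C : MConfig) (P : MCell) (g k j k' : Fin 4) :
    CoveredAbove (configDil m C) (cellDil m P) g k j k' ↔ CoveredAbove C P g k j k' := by
  simp only [CoveredAbove, cellDil_apply, dirOK_dilPt hm.ne', mcoverAbove_dil hm]

theorem coord_ne_dil (hm : m ≠ 0) (x y : BPoint) (k k' : Fin 4) :
    coord (dilPt m x) k ≠ coord (dilPt m y) k' ↔ coord x k ≠ coord y k' := by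
  simp only [ne_eq, coord_dilPt, mul_eq_mul_left_iff, hm, or_false]

theorem ruleDMu4N_dil (hm : 0 < m) (C : MConfig) (Z : MCell) :
    RuleDMu4N (configDil m C) (cellDil m Z) ↔ RuleDMu4N C Z := by
  simp only [RuleDMu4N, settledBelow_dil hm, coveredBelow_dil hm, cellDil_apply, adapted_dilPt hm.ne', coord_ne_dil hm.ne']

theorem ruleDMu4P_dil (hm : 0 < m) (C : MConfig) (P : MCell) :
    RuleDMu4P (configDil m C) (cellDil m P) ↔ RuleDMu4P C P := by
  simp only [RuleDMu4P, settledAbove_dil hm, coveredAbove_dil hm, cellDil_apply, adapted_dilPt hm.ne', coord_ne_dil hm.ne']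

/-- **RULE D μ₄ IS `D_m`-INVARIANT** (`m ≥ 1`). [kernel] -/
theorem ruleDMu4Closed_dil (hm : 0 < m) (C : MConfig) : RuleDMu4Closed (configDil m C) ↔ RuleDMu4Closed C := by
  simp only [RuleDMu4Closed, forall_lower_dil, forall_upper_dil, ruleDMu4N_dil hm, ruleDMu4P_dil hm]

/-- `D_m` commutes with factor permutations … -/
theorem cellDil_perm (m : ℤ) (σ : Equiv.Perm (Fin 4)) (Z : MCell) : cellDil m (Z.perm σ) = (cellDil m Z).perm σ := rfl

/-- … and with the diagonal CM rotation `Δ`. -/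
theorem cellDil_delta (m : ℤ) (Z : MCell) : cellDil m Z.delta = (cellDil m Z).delta := by
  funext f
  simp only [cellDil_apply, MCell.delta, deltaPt, dilPt, mul_neg]

theorem permClosed_dil (hm : m ≠ 0) (S : Finset MCell) : PermClosed (S.image (cellDil m)) ↔ PermClosed S := by
  simp only [PermClosed, Finset.forall_mem_image, ← cellDil_perm, (cellDil_injective hm).mem_finset_image]

theorem deltaClosed_dil (hm : m ≠ 0) (S : Finset MCell) : DeltaClosed (S.image (cellDil m)) ↔ DeltaClosed S := by
  simp only [DeltaClosed, Finset.forall_mem_image, ← cellDil_delta, (cellDil_injective hm).mem_finset_image]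

/-- **`G₁`-CLOSEDNESS IS `D_m`-INVARIANT** (`m ≠ 0`). [kernel] -/
theorem g1Closed_dil (hm : m ≠ 0) (C : MConfig) : (configDil m C).G1Closed ↔ C.G1Closed := by
  simp only [MConfig.G1Closed, configDil, permClosed_dil hm, deltaClosed_dil hm]

/-! #### the `X` and `A2I` instance families (both worlds) -/

theorem mlt_dil (hm : 0 < m) (p q : ℤ) : m * p < m * q ↔ p < q :=
  ⟨fun h => lt_of_mul_lt_mul_left h hm.le, fun h => mul_lt_mul_of_pos_left h hm⟩

theorem mle_dil (hm : 0 < m) (p q : ℤ) : m * p ≤ m * q ↔ p ≤ q :=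
  ⟨fun h => le_of_mul_le_mul_left h hm, fun h => mul_le_mul_of_nonneg_left h hm.le⟩

theorem msq_le_dil (hm : m ≠ 0) (p q : ℤ) : m ^ 2 * p ≤ m ^ 2 * q ↔ p ≤ q :=
  ⟨fun h => le_of_mul_le_mul_left h (by positivity), fun h => mul_le_mul_of_nonneg_left h (sq_nonneg m)⟩

theorem msq_lt_dil (hm : m ≠ 0) (p q : ℤ) : m ^ 2 * p < m ^ 2 * q ↔ p < q :=
  ⟨fun h => lt_of_mul_lt_mul_left h (sq_nonneg m), fun h => mul_lt_mul_of_pos_left h (by positivity)⟩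

theorem msq_eq_dil (hm : m ≠ 0) (p q : ℤ) : m ^ 2 * p = m ^ 2 * q ↔ p = q :=
  ⟨fun h => mul_left_cancel₀ (pow_ne_zero 2 hm) h, fun h => by rw [h]⟩

theorem nonneg_fst_dil (hm : 0 < m) (x : BPoint) : 0 ≤ (dilPt m x).1 ↔ 0 ≤ x.1 := by
  show 0 ≤ m * x.1 ↔ 0 ≤ x.1
  simpa using mle_dil hm 0 x.1

theorem fst_neg_dil (hm : 0 < m) (x : BPoint) : (dilPt m x).1 < 0 ↔ x.1 < 0 := by
  show m * x.1 < 0 ↔ x.1 < 0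
  simpa using mlt_dil hm x.1 0

theorem bsub_dil (m : ℤ) (x y : BPoint) : bsub (dilPt m x) (dilPt m y) = dilPt m (bsub x y) := by
  refine Prod.ext ?_ (Prod.ext ?_ ?_) <;> simp [bsub, dilPt] <;> ring

theorem effective_dil (hm : 0 < m) (Δ : BPoint) : Effective (dilPt m Δ) ↔ Effective Δ := by
  obtain ⟨a, b, c⟩ := Δ
  simp only [Effective, dilPt]
  rw [show (m * b) ^ 2 + (m * c) ^ 2 = m ^ 2 * (b ^ 2 + c ^ 2) by ring, show (m * a) ^ 2 = m ^ 2 * a ^ 2 by ring,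
    msq_le_dil hm.ne', show (0 : ℤ) ≤ m * a ↔ 0 ≤ a by simpa using mle_dil hm 0 a]

theorem timelike_dil (hm : m ≠ 0) (Δ : BPoint) : Timelike (dilPt m Δ) ↔ Timelike Δ := by
  obtain ⟨a, b, c⟩ := Δ
  simp only [Timelike, dilPt]
  rw [show (m * b) ^ 2 + (m * c) ^ 2 = m ^ 2 * (b ^ 2 + c ^ 2) by ring, show (m * a) ^ 2 = m ^ 2 * a ^ 2 by ring,
    msq_lt_dil hm]

theorem spacelike_dil (hm : m ≠ 0) (Δ : BPoint) : Spacelike (dilPt m Δ) ↔ Spacelike Δ := by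
  obtain ⟨a, b, c⟩ := Δ
  simp only [Spacelike, dilPt]
  rw [show (m * b) ^ 2 + (m * c) ^ 2 = m ^ 2 * (b ^ 2 + c ^ 2) by ring, show (m * a) ^ 2 = m ^ 2 * a ^ 2 by ring,
    msq_lt_dil hm]

theorem nullBelow_dil (hm : 0 < m) (y x : BPoint) : NullBelow (dilPt m y) (dilPt m x) ↔ NullBelow y x := by
  obtain ⟨a, b, c⟩ := x
  obtain ⟨a', b', c'⟩ := y
  simp only [NullBelow, dilPt]
  rw [show (m * b - m * b') ^ 2 + (m * c - m * c') ^ 2 = m ^ 2 * ((b - b') ^ 2 + (c - c') ^ 2) by ring,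
    show (m * a - m * a') ^ 2 = m ^ 2 * (a - a') ^ 2 by ring, msq_eq_dil hm.ne', mlt_dil hm]

theorem cabs_dil (hm : 0 ≤ m) (x : BPoint) : cabs (dilPt m x) = m * cabs x := by
  obtain ⟨a, b, c⟩ := x
  simp only [cabs, dilPt, abs_mul, abs_of_nonneg hm]
  exact (mul_max_of_nonneg |b| |c| hm).symm

theorem encDir_dil (hm : 0 < m) (x : BPoint) (u : Fin 4) : EncDir (dilPt m x) u ↔ EncDir x u := by
  have hc : cabs (dilPt m x) = m * cabs x := cabs_dil hm.le x
  have h1 : (dilPt m x).1 = m * x.1 := rfl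
  have e1 : (m * x.1 - m * cabs x, (0 : ℤ), (0 : ℤ)) = dilPt m (x.1 - cabs x, 0, 0) := by
    refine Prod.ext ?_ (Prod.ext ?_ ?_) <;> simp [dilPt] <;> ring
  have e2 : (m * x.1 + m * cabs x, (0 : ℤ), (0 : ℤ)) = dilPt m (x.1 + cabs x, 0, 0) := by
    refine Prod.ext ?_ (Prod.ext ?_ ?_) <;> simp [dilPt] <;> ring
  have e3 : -(m * cabs x) = m * (-cabs x) := by ring
  simp only [EncDir, hc, h1, e1, e2, e3, ← dilPt_ray, dilPt_inj hm.ne']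
  rw [show (0 : ℤ) ≤ m * x.1 ↔ 0 ≤ x.1 by simpa using mle_dil hm 0 x.1, show m * x.1 < 0 ↔ x.1 < 0 by simpa using mlt_dil hm x.1 0]

theorem sibling_dil (hm : 0 < m) (q n : MCell) (σ k' : Fin 4) :
    Sibling (cellDil m q) (cellDil m n) σ k' ↔ Sibling q n σ k' := by
  simp only [Sibling, magree_dil hm.ne', cellDil_apply, fst_lt_dil hm, eq_ray_dil hm.ne']

theorem noCompanion_dil (hm : 0 < m) (C : MConfig) (q n : MCell) (σ k' : Fin 4) :
    NoCompanion (configDil m C) (cellDil m q) (cellDil m n) σ k' ↔ NoCompanion C q n σ k' := by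
  simp only [NoCompanion, forall_upper_dil, magree_dil hm.ne', cellDil_apply, fst_lt_dil hm, ne_eq, eq_ray_dil hm.ne']

theorem heOkP_dil (hm : 0 < m) (C : MConfig) (Z q n : MCell) (σ : Fin 4) :
    HeOkP (configDil m C) (cellDil m Z) (cellDil m q) (cellDil m n) σ ↔ HeOkP C Z q n σ := by
  simp only [HeOkP, forall_upper_dil, magree_dil hm.ne', cellDil_apply, ne_eq, dilPt_inj hm.ne', bsub_dil,
    effective_dil hm, timelike_dil hm.ne']

theorem hbOkP_dil (hm : 0 < m) (C : MConfig) (Z n : MCell) (σ f : Fin 4) :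
    HbOkP (configDil m C) (cellDil m Z) (cellDil m n) σ f ↔ HbOkP C Z n σ f := by
  simp only [HbOkP, forall_upper_dil, magree2_dil hm.ne', cellDil_apply, nullBelow_dil hm, bsub_dil, effective_dil hm,
    timelike_dil hm.ne']

theorem wfEmpty_dil (hm : 0 < m) (C : MConfig) (Z : MCell) (f : Fin 4) :
    WfEmpty (configDil m C) (cellDil m Z) f ↔ WfEmpty C Z f := by
  simp only [WfEmpty, forall_upper_dil, magree_dil hm.ne', magree2_dil hm.ne', cellDil_apply, nullBelow_dil hm]

theorem xresXFires_dil (hm : 0 < m) (C : MConfig) (Z q n : MCell) (σ u w f : Fin 4) :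
    XresXFires (configDil m C) (cellDil m Z) (cellDil m q) (cellDil m n) σ u w f ↔ XresXFires C Z q n σ u w f := by
  simp only [XresXFires, upartner_dil hm, sibling_dil hm, noCompanion_dil hm, heOkP_dil hm, hbOkP_dil hm, wfEmpty_dil hm,
    forall_upper_dil, cellDil_apply, isApex_dilPt hm.ne', fst_le_dil hm]

theorem xresXClosed_dil (hm : 0 < m) (C : MConfig) : XresXClosed (configDil m C) ↔ XresXClosed C := by
  simp only [XresXClosed, forall_lower_dil, forall_upper_dil, xresXFires_dil hm]

/-- the A2I GUARD `d ≤ cabs` is `D_m`-invariant. -/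
theorem guard_dil (hm : 0 < m) (x y : BPoint) :
    (0 ≤ (dilPt m x).1 → (dilPt m x).1 - (dilPt m y).1 ≤ cabs (dilPt m x)) ↔ (0 ≤ x.1 → x.1 - y.1 ≤ cabs x) := by
  rw [cabs_dil hm.le, nonneg_fst_dil hm, show (dilPt m x).1 - (dilPt m y).1 = m * (x.1 - y.1) by simp only [dilPt]; ring,
    mle_dil hm]

theorem onULineBelowEq_dil (hm : 0 < m) (x y : BPoint) (u : Fin 4) :
    OnULineBelowEq (dilPt m x) (dilPt m y) u ↔ OnULineBelowEq x y u := by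
  simp only [OnULineBelowEq, fst_le_dil hm, eq_ray_dil hm.ne']

/-- the (3b) lift clause `α(Z) < α(P) ≤ α(N′) ∧ P = Z + e·n_v`. -/
theorem liftClause_dil (hm : 0 < m) (z p n : BPoint) (v : Fin 4) :
    ((dilPt m z).1 < (dilPt m p).1 ∧ (dilPt m p).1 ≤ (dilPt m n).1 ∧ dilPt m p = ray (dilPt m z) v ((dilPt m p).1 - (dilPt m z).1)) ↔
      (z.1 < p.1 ∧ p.1 ≤ n.1 ∧ p = ray z v (p.1 - z.1)) := by
  simp only [fst_lt_dil hm, fst_le_dil hm, eq_ray_dil hm.ne']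

theorem xresA2IFires_dil (hm : 0 < m) (C : MConfig) (Z q N' : MCell) (σ u f' v : Fin 4) :
    XresA2IFires (configDil m C) (cellDil m Z) (cellDil m q) (cellDil m N') σ u f' v ↔ XresA2IFires C Z q N' σ u f' v := by
  simp only [XresA2IFires, upartner_dil hm, forall_upper_dil, cellDil_apply, isApex_dilPt hm.ne', encDir_dil hm, guard_dil hm,
    magree_dil hm.ne', magree2_dil hm.ne', nullBelow_dil hm, eq_ray_dil hm.ne', dilPt_inj hm.ne', onULineBelowEq_dil hm,
    liftClause_dil hm, fst_lt_dil hm, fst_le_dil hm, bsub_dil, effective_dil hm, spacelike_dil hm.ne']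

theorem xresA2IClosed_dil (hm : 0 < m) (C : MConfig) : XresA2IClosed (configDil m C) ↔ XresA2IClosed C := by
  simp only [XresA2IClosed, forall_lower_dil, forall_upper_dil, xresA2IFires_dil hm]

/-- `D_m` commutes with the dual world `(α, β) ↦ (−α, −β)` (sides swapped). -/
theorem cellDil_dualCell (m : ℤ) (Z : MCell) : cellDil m (dualCell 0 Z) = dualCell 0 (cellDil m Z) := by
  funext f
  refine Prod.ext ?_ (Prod.ext ?_ ?_) <;> simp [cellDil_apply, dualCell, dualPt, dilPt]

theorem configDil_dual (m : ℤ) (C : MConfig) : (configDil m C).dual 0 = configDil m (C.dual 0) := by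
  have hc : dualCell 0 ∘ cellDil m = cellDil m ∘ dualCell 0 := funext fun Z => (cellDil_dualCell m Z).symm
  simp only [MConfig.dual, configDil, Finset.image_image, hc]

/-- **THE FOUR INSTANCE FAMILIES ARE `D_m`-INVARIANT** (`m ≥ 1`). [kernel] -/
theorem xresFourClosed_dil (hm : 0 < m) (C : MConfig) : XresFourClosed (configDil m C) ↔ XresFourClosed C := by
  simp only [XresFourClosed, XMinusClosed, XPlusClosed, A2IMinusClosed, A2IPlusClosed, configDil_dual, xresXClosed_dil hm,
    xresA2IClosed_dil hm]

/-- **STATIC DILATION INVARIANCE, PROVED** for the typed families of record (RULE D μ₄, the four instance families, `G₁`). -/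
theorem staticDilationInvariant_holds : StaticDilationInvariant := fun C m hm =>
  ⟨(ruleDMu4Closed_dil hm C).symm, (xresFourClosed_dil hm C).symm, (g1Closed_dil (by omega) C).symm⟩

end Invariance

/-! ### `decide` probes: the tree's probe configurations keep their verdicts under `D_2` -/

section Probes

set_option synthInstance.maxSize 8192 in
set_option synthInstance.maxHeartbeats 2000000 in
/-- RULE D (R-O) probe pair under `D_2`: passes ∕ fails exactly as undilated (`Pad4TowerRuleDMu4.ownPhaseProbe_ruleD`). [kernel, `decide`] -/
theorem ownPhaseProbe_ruleD_dil :
    RuleDMu4N (configDil 2 ownPhaseProbe) (cellDil 2 nOwnPhase) ∧ ¬ RuleDMu4N (configDil 2 ownPhaseProbe') (cellDil 2 nOwnPhase) := by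
  constructor <;> decide +kernel

set_option synthInstance.maxSize 8192 in
set_option synthInstance.maxHeartbeats 2000000 in
/-- RULE D tower census pair under `D_2` (`towerNextToO_census`): fails in `D_2 U5`, passes in `D_2 U6`. [kernel, `decide`] -/
theorem towerNextToO_census_dil :
    ¬ RuleDMu4N (configDil 2 towerNextToO_U5) (cellDil 2 nTowerNextToO) ∧
      RuleDMu4N (configDil 2 towerNextToO_U6) (cellDil 2 nTowerNextToO) := by
  constructor <;> decide +kernel

set_option synthInstance.maxSize 8192 in
set_option synthInstance.maxHeartbeats 2000000 in
/-- `A2I−` probe under `D_2`: the D_ML8 pattern still FIRES (`dml8Pattern_xres`). [kernel, `decide`] -/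
theorem dml8Pattern_xres_dil : ¬ A2IMinusClosed (configDil 2 dml8Pattern) := by
  decide +kernel

set_option synthInstance.maxSize 8192 in
set_option synthInstance.maxHeartbeats 2000000 in
/-- `X−` probe pair under `D_2`: §22's column still FIRES and its sibling-free sub-configuration is still closed (`j275278Column_xres`).
[kernel, `decide`] -/
theorem j275278Column_xres_dil : ¬ XMinusClosed (configDil 2 j275278Column) ∧
    XMinusClosed (configDil 2 ⟨{mcellOf (0,0,0) (0,0,0) (lpt 1 2) (lpt 6 2)}, {mcellOf (0,0,0) (0,0,0) (0,0,0) (lpt 6 2)}⟩) := by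
  constructor <;> decide +kernel

end Probes

end Summit.HodgeConjecture.HodgeConjecture.Cruxes.BlochSeedDiscOne.StrengthenDilation
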